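import Literature.MathematicalPhysics.QuantumFieldTheory.Balaban1983to89.Node00.BgAveragingOfRecord
import Literature.MathematicalPhysics.QuantumFieldTheory.Balaban1983to89.B15DeterminingSets
import HarnessLib

/-!
# The record's FLAT site letter `Q′♭ λ = λ ∘ embIter k` — the gauge letter of the (0.4) averaging of record (M1 file 3c)

statement-level skeleton of published definitions with citation tags; nothing here is a claim about the Yang–Mills mass gap
(cell `pub-ymgap`, unit `pub-ymgap-node00-def-Y` g36; Node00 = the record `(F : T4Family, SU(N), avOfRecord)`).

WHAT IS HERE (additive to file 3b `Node00.BgAveragingOfRecord`; nothing landed is changed).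
* §1 `QflatOfRecord F N k : SiteL2K ℂ … (c0Rec F K k) (WRec N) →ₗ[ℂ] (Site (F.P K) k → M_N(ℂ))` — RESTRICTION of a (read-in) site field of the finest
  lattice to the centres of the `k`-blocks: `(Q′♭ λ)(y) = λ(embIter k y)` (`B15DeterminingSets.embIter`, the iterated centre embedding `Setup.emb` of
  [Balaban1987RG1] p.251).  It does not depend on the background.
* §2 the two handles of file 3a re-read at this site letter (SAME formulas `Node00.frakGOfRecord` ∕ `Node00.H1OfRecord`; only the `Q′`-argument differs
  from 3b's `frakGOfRecordAtBg` ∕ `H1OfRecordAtBg`): `frakGOfRecordAtBgFlat F N K k Ω U₀ a hpos hQ` and `H1OfRecordAtBgFlat …`, with the positivity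
  hypothesis `hpos` DISPLAYED over `laplaceAOfRecord F N k U₀ (QOfRecord F N k U₀) (QflatOfRecord F N k) a` and `hQ : Function.Surjective (QOfRecord F N k U₀)`.

WHY THIS LETTER (the kernel fact).  The record's averaging operation `avOfRecord = blockAvg expMeanLogSU` ([Balaban1987RG1] (0.4)) is gauge covariant under
RESTRICTION of the gauge function to the block centres — `Setup.Averaging.covariant` («`avg (U^u) = (avg U)^{fun y ↦ u (emb y)}`», [Balaban1985Averaging] (11)
«Ū^u = (Ū)^u»), iterated in `T4Continuum.iter_gaugeAct` («`Ū^k(U^u) = (Ū^k U)^{transfUp u k}`», `transfUp u k = u ∘ embIter k`) — at EVERY configuration and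
with NO parallel transport.  Hence the coarse gauge map of the record is `u ↦ u ∘ embIter k`, the fine (residual) gauge group of the constrained variational
problem `Ū^k(U) = V` of [Balaban1985Variational] (12)–(15) is `{u : u ∘ embIter k = 1}`, and the linearisation of the coarse gauge map at any background is
`Q′♭`.  The intertwining relation between the bond letter `Q(U₀)` (file 3b `QOfRecord`, the derivative of `U ↦ Ū^k(U)`) and the site letter — [Balaban1984PropagatorsI]
(1.55) «`Q_k ∂ = ∂₁ Q′_k`», the identity behind the Landau-type gauge (21) of [Balaban1985Variational] and the positivity of `Δ_a` ([Balaban1985BackgroundPropagators]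
Thm 3.11) — is, at the record, the derivative of that covariance identity, i.e. it holds for the pair `(QOfRecord U₀, Q′♭)`; at the unit background it reads
`Q(1)(∂φ) = L^{-k}·∂(φ ∘ embIter k)` (the cell's Summits-side `dIterL_one_grad`, `qSkewOp_one_apply`).  PRINT's site averaging ([Balaban1985Averaging] (78),
[Balaban1985BackgroundPropagators] (3.18)–(3.19): the transported block mean ∕ block exp-mean-log average of gauge transformations) is typed VERBATIM as
`Node00.QprimeOfRecord` in file 3b and STAYS as landed: it is the site letter of print's own bookkeeping, in which the residual gauge is fixed by the averaged
condition [Balaban1985Averaging] (81) «`R₀^k u = 1`»; for the pair `(QOfRecord 1, QprimeOfRecord 1)` the intertwining (1.55) fails (a site function supported in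
one `k`-block with block mean `0` and non-zero value at the centre witnesses it — located by the cell's N07 seat, bus 2026-08-31), which is why the record's
`𝔊(U₀)` is offered here at `Q′♭`.

HONEST LABELS.  (1) DEFINITIONAL only: no positivity (`hpos`), no surjectivity (`hQ`), no intertwining lemma and no estimate is asserted in this file.
(2) WHICH site letter the cell's `𝒢`-pin carries is a director's ruling (the pin of record names `frakGOfRecordAtBg`; `frakGOfRecordAtBgFlat` is its proposed
amendment); both are `frakGOfRecord` of file 3a at different `Q′`-arguments, so every letter-generic theorem about `frakGOfRecord … Q Q′ …` serves both.
(3) COUNT∕K unchanged by this file; finite `𝕋⁴` at fixed `ε` throughout; nothing continuum ∕ OS ∕ Clay.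
-/

noncomputable section

open scoped Matrix Matrix.Norms.L2Operator InnerProductSpace ComplexConjugate

namespace Literature.MathematicalPhysics.QuantumFieldTheory.Balaban1983to89.Node00

open T4Continuum BlockAveraging
open B4Sect5Torus (TSite)
open B9SectCLatticeCarrier (Bond)
open B9Eq311L2Pairing (WL2)
open B11Eq103H1Complex (SiteL2K BondL2K)
open B11Eq115Space (NegSize)
open B15DeterminingSets (embIter)

section Record

variable (F : T4Family) (N : ℕ) {K : ℕ} (k : ℕ)

/-! ## §1. The flat site letter `Q′♭`: restriction to the `k`-centres -/

/-- ★ **`Q′♭` OF RECORD** — the site letter of the record's averaging: restriction of a site field of the finest lattice (read in from the lit carrier by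
`siteFieldIn`) to the centres `embIter k y` of the `k`-blocks, `(Q′♭ λ)(y) = λ(embIter k y)`; the linearisation of the coarse gauge map `u ↦ u ∘ embIter k`
under which the record's averaging is covariant (`Setup.Averaging.covariant`, `T4Continuum.iter_gaugeAct`).  Background-independent.
[cite: Balaban1985Averaging, (11) p.19; Balaban1987RG1, (0.4) p.252, p.251; Balaban1984PropagatorsI, (1.55) p.27 (shape)] -/
def QflatOfRecord : SiteL2K ℂ (F.P K).d (fun _ => (F.P K).sitesPerDir 0) (c0Rec F K k) (WRec N) →ₗ[ℂ] (Site (F.P K) k → Matrix (Fin N) (Fin N) ℂ) :=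
  LinearMap.funLeft ℂ (Matrix (Fin N) (Fin N) ℂ) (embIter k) ∘ₗ siteFieldIn F N k

/-- Unfolding of `QflatOfRecord`: evaluation at a `k`-site is the read-in field at its centre. [cite: Balaban1985Averaging, (11) p.19 (bookkeeping)] -/
@[simp] theorem QflatOfRecord_apply (f : SiteL2K ℂ (F.P K).d (fun _ => (F.P K).sitesPerDir 0) (c0Rec F K k) (WRec N)) (y : Site (F.P K) k) :
    QflatOfRecord F N k f y = siteFieldIn F N k f (embIter k y) := rfl

/-- `Q′♭` as restriction of the matrix-valued field: `Q′♭ = (· ∘ embIter k) ∘ siteFieldIn`. [cite: Balaban1985Averaging, (11) p.19 (bookkeeping)] -/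
theorem QflatOfRecord_eq_comp (f : SiteL2K ℂ (F.P K).d (fun _ => (F.P K).sitesPerDir 0) (c0Rec F K k) (WRec N)) :
    QflatOfRecord F N k f = siteFieldIn F N k f ∘ embIter k := rfl

/-- At level `0` the flat site letter is the read-in itself (`embIter 0 = id`). [cite: Balaban1985Averaging, (11) p.19 (bookkeeping)] -/
@[simp] theorem QflatOfRecord_zero (f : SiteL2K ℂ (F.P K).d (fun _ => (F.P K).sitesPerDir 0) (c0Rec F K 0) (WRec N)) :
    QflatOfRecord F N 0 f = siteFieldIn F N 0 f := rfl

/-- `Q′♭` kills exactly the site fields vanishing at every `k`-centre (the Lie algebra of the record's fine gauge group `{u : u ∘ embIter k = 1}`, read in).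
[cite: Balaban1985Averaging, (11) p.19; Balaban1985Variational, (21) p.281 (shape)] -/
theorem QflatOfRecord_eq_zero_iff (f : SiteL2K ℂ (F.P K).d (fun _ => (F.P K).sitesPerDir 0) (c0Rec F K k) (WRec N)) :
    QflatOfRecord F N k f = 0 ↔ ∀ y : Site (F.P K) k, siteFieldIn F N k f (embIter k y) = 0 :=
  funext_iff

/-! ## §2. The handles `𝔊(U₀)`, `H₁(U₀)` of record at the flat site letter — data `a`; displayed `hpos`, `hQ` -/

variable (Ω : ℕ → Set (Site (F.P K) 0)) (U₀ : GaugeField (F.P K) 0 (SU N))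

variable (K) in
/-- ★★★ **`𝔊(U₀)` OF RECORD AT THE LETTERS `(Q(U₀), Q′♭)`** — `frakGOfRecord` (file 3a) with its `Q`-slot filled by the record's bond letter `QOfRecord F N k U₀`
(file 3b) and its `Q′`-slot by the flat site letter `QflatOfRecord F N k`; hypotheses: the number `a`, and the DISPLAYED proofs `hpos`
([Balaban1985BackgroundPropagators] Thm 3.11 at the record, for this pair) and `hQ` (`Q(U₀)` onto).  Same formula as 3b's `frakGOfRecordAtBg`, other `Q′`-argument.
[cite: Balaban1985Variational, (110)–(111) p.294, (116)–(117) p.295; Balaban1985BackgroundPropagators, Thm 3.11 p.416; Balaban1985Averaging, (11) p.19] -/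
def frakGOfRecordAtBgFlat [Fact (0 < (F.L : ℝ))] [Fact (0 < (F.P K).eta k)] [Fact (0 < c0Rec F K k)] [Fact (∀ c, 0 < wBRec F K k c)] (a : ℝ)
    (hpos : ∀ x, x ≠ 0 → 0 < RCLike.re ⟪x, laplaceAOfRecord F N k U₀ (QOfRecord F N k U₀) (QflatOfRecord F N k) a x⟫_ℂ)
    (hQ : Function.Surjective (QOfRecord F N k U₀)) :
    NegSizeLit F N K k Ω 3 →L[ℂ] Space115Lit F N K k Ω U₀ :=
  frakGOfRecord F N K k Ω U₀ (QOfRecord F N k U₀) (QflatOfRecord F N k) a hpos hQ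

variable (K) in
/-- Unfolding (`rfl`): the flat-letter `𝔊(U₀)` is `frakGOfRecord` at `(QOfRecord U₀, QflatOfRecord)`. [cite: Balaban1985Variational, (116)–(117) p.295 (bookkeeping)] -/
theorem frakGOfRecordAtBgFlat_eq [Fact (0 < (F.L : ℝ))] [Fact (0 < (F.P K).eta k)] [Fact (0 < c0Rec F K k)] [Fact (∀ c, 0 < wBRec F K k c)] (a : ℝ)
    (hpos : ∀ x, x ≠ 0 → 0 < RCLike.re ⟪x, laplaceAOfRecord F N k U₀ (QOfRecord F N k U₀) (QflatOfRecord F N k) a x⟫_ℂ)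
    (hQ : Function.Surjective (QOfRecord F N k U₀)) :
    frakGOfRecordAtBgFlat F N K k Ω U₀ a hpos hQ = frakGOfRecord F N K k Ω U₀ (QOfRecord F N k U₀) (QflatOfRecord F N k) a hpos hQ := rfl

variable (K) in
/-- **`H₁(U₀)` OF RECORD AT THE LETTERS `(Q(U₀), Q′♭)`** (block levels `levB` a datum, as in `H1OfRecord`).
[cite: Balaban1985Variational, (45) p.285, (103) p.293, (174) p.305; Balaban1985Averaging, (11) p.19] -/
def H1OfRecordAtBgFlat [Fact (0 < (F.L : ℝ))] [Fact (0 < (F.P K).eta k)] [Fact (0 < c0Rec F K k)] [Fact (∀ c, 0 < wBRec F K k c)]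
    (levB : PBond (F.P K) k → ℕ) (a : ℝ)
    (hpos : ∀ x, x ≠ 0 → 0 < RCLike.re ⟪x, laplaceAOfRecord F N k U₀ (QOfRecord F N k U₀) (QflatOfRecord F N k) a x⟫_ℂ)
    (hQ : Function.Surjective (QOfRecord F N k U₀)) :
    NegSize (F.L : ℝ) ((F.P K).eta k) levB 0 (Matrix (Fin N) (Fin N) ℂ) →L[ℂ] Space115Lit F N K k Ω U₀ :=
  H1OfRecord F N K k Ω U₀ levB (QOfRecord F N k U₀) (QflatOfRecord F N k) a hpos hQ

variable (K) in
/-- Unfolding (`rfl`): the flat-letter `H₁(U₀)` is `H1OfRecord` at `(QOfRecord U₀, QflatOfRecord)`. [cite: Balaban1985Variational, (103) p.293 (bookkeeping)] -/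
theorem H1OfRecordAtBgFlat_eq [Fact (0 < (F.L : ℝ))] [Fact (0 < (F.P K).eta k)] [Fact (0 < c0Rec F K k)] [Fact (∀ c, 0 < wBRec F K k c)]
    (levB : PBond (F.P K) k → ℕ) (a : ℝ)
    (hpos : ∀ x, x ≠ 0 → 0 < RCLike.re ⟪x, laplaceAOfRecord F N k U₀ (QOfRecord F N k U₀) (QflatOfRecord F N k) a x⟫_ℂ)
    (hQ : Function.Surjective (QOfRecord F N k U₀)) :
    H1OfRecordAtBgFlat F N K k Ω U₀ levB a hpos hQ = H1OfRecord F N K k Ω U₀ levB (QOfRecord F N k U₀) (QflatOfRecord F N k) a hpos hQ := rfl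

end Record

end Literature.MathematicalPhysics.QuantumFieldTheory.Balaban1983to89.Node00

end
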